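import Summits.MatrixMultiplication.OmegaCensus.STPPVosperSlackFourCell22Checker
import Summits.MatrixMultiplication.OmegaCensus.STPPVosperSlackFourCell22Shapes
import Summits.MatrixMultiplication.OmegaCensus.STPPZoo313TableP4

/-!
# ω-census (abelian STPP census): cell (2,2) of the slack-4 law — kernel CERTIFICATES linking the shape table to the zoo (kernel computations)

HONEST FRAMING (pub-omega census; verbatim): lottery ticket; floor = certified bounds/negative ranges.
Census STRUCTURE (seat pub-omega-stpp-2 gen 28, 2026-08-29), family (b2).  `decide` facts used by the cell-(2,2) reduction
(`STPPVosperSlackFourCell22Reduce.lean`): (1) every zoo pair `(y, B) ∈ zooTbl61` (`STPPZoo313TableP1–4.lean`) has its key in the 14-element key list,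
its class map `c22Cls y = (y₀, μ, c)` sends `{0,1,y}` onto `{0,1,y₀}` (`μ ≠ 0`, an identity of 3-subsets of `ZMod 61`), and the rotation normal form of
the affine image of the sumset mask `{0,1,y} + B` is listed in `c22Sh y₀` (`STPPVosperSlackFourCell22Shapes.lean`); (2) every listed shape is below `2^61`,
is recovered from its cyclic runs (`dilRunsMask 61 1 (runsOf 61 S) = S`) and has run lengths `≤ 17`.  Nothing here is progress on `ω`.

References: H. Cohn, R. Kleinberg, B. Szegedy, C. Umans, FOCS 2005 (arXiv:math/0511460), Def. 5.1.
-/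

namespace Summit.MatrixMultiplication.OmegaCensus.CubeNB.S2

open Summit.MatrixMultiplication.OmegaCensus.CubeNB.Bits

/-- The 14 zoo keys (the anharmonic classes of 2, 3, 4 without 60). [folklore] -/
def c22Keys : List ℕ := [2, 31, 3, 21, 30, 32, 41, 59, 4, 16, 20, 42, 46, 58]

/-- The shape-table test of one zoo pair: key listed and the class-normalised sumset shape listed. [folklore] -/
def c22ZooOK (e : ℕ × ℕ) : Bool :=
  c22Keys.elem e.1 && (c22Sh (c22Cls e.1).1).elem (normMask 61 (affMask 61 (c22Cls e.1).2.1 (c22Cls e.1).2.2 (sumMask 61 [0, 1, e.1] e.2)))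

/-- Zoo pairs, part 1: keys and shapes listed. [folklore] -/
theorem c22ZooOK_a : (zooTbl61a.all c22ZooOK) = true := by decide +kernel

/-- Zoo pairs, part 2: keys and shapes listed. [folklore] -/
theorem c22ZooOK_b : (zooTbl61b.all c22ZooOK) = true := by decide +kernel

/-- Zoo pairs, part 3: keys and shapes listed. [folklore] -/
theorem c22ZooOK_c : (zooTbl61c.all c22ZooOK) = true := by decide +kernel

/-- Zoo pairs, part 4: keys and shapes listed. [folklore] -/
theorem c22ZooOK_d : (zooTbl61d.all c22ZooOK) = true := by decide +kernel

/-- **Every zoo pair has a listed key and a listed class-normalised shape.** [folklore] -/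
theorem c22ZooOK_all : ∀ e ∈ zooTbl61, c22ZooOK e = true := by
  intro e he
  rw [zooTbl61, List.mem_append, List.mem_append, List.mem_append] at he
  rcases he with ((he | he) | he) | he
  · exact List.all_eq_true.1 c22ZooOK_a e he
  · exact List.all_eq_true.1 c22ZooOK_b e he
  · exact List.all_eq_true.1 c22ZooOK_c e he
  · exact List.all_eq_true.1 c22ZooOK_d e he

/-- **The class maps are affine bijections of `ZMod 61` sending `{0,1,y}` onto `{0,1,y₀}`** (`y₀ ∈ {2,3,4}`, `μ ≠ 0`). [folklore] -/
theorem c22Cls_spec : ∀ y ∈ c22Keys, (c22Cls y).1 ∈ [2, 3, 4] ∧ (((c22Cls y).2.1 : ℕ) : ZMod 61) ≠ 0 ∧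
    Finset.image (fun v : ZMod 61 => (((c22Cls y).2.1 : ℕ) : ZMod 61) * v + (((c22Cls y).2.2 : ℕ) : ZMod 61)) {0, 1, ((y : ℕ) : ZMod 61)} =
      {0, 1, (((c22Cls y).1 : ℕ) : ZMod 61)} := by
  decide

/-- **The listed shapes are below `2^61`, recovered from their runs, with run lengths `≤ 17`.** [folklore] -/
theorem c22Sh_runs : ∀ y₀ ∈ [2, 3, 4], ∀ S ∈ c22Sh y₀,
    S < 2 ^ 61 ∧ dilRunsMask 61 1 (runsOf 61 S) = S ∧ ∀ r ∈ runsOf 61 S, r.2 ≤ 17 := by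
  have h : ([2, 3, 4].all fun y₀ => (c22Sh y₀).all fun S =>
      Nat.blt S (2 ^ 61) && Nat.beq (dilRunsMask 61 1 (runsOf 61 S)) S && (runsOf 61 S).all fun r => Nat.ble r.2 17) = true := by
    decide +kernel
  intro y₀ hy₀ S hS
  have h1 := List.all_eq_true.1 (List.all_eq_true.1 h y₀ hy₀) S hS
  simp only [Bool.and_eq_true, List.all_eq_true] at h1
  obtain ⟨⟨hlt, hrt⟩, hle⟩ := h1
  exact ⟨by simpa using hlt, Nat.eq_of_beq_eq_true hrt, fun r hr => Nat.le_of_ble_eq_true (hle r hr)⟩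

end Summit.MatrixMultiplication.OmegaCensus.CubeNB.S2
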